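import Mathlib
import Summits.ResolutionOfSingularities.ResolutionOfSingularities.Theorems.RadicialJungCleanModelsBadSetDescentData
import Summits.ResolutionOfSingularities.ResolutionOfSingularities.Theorems.RadicialJungCleanModelsCleanPermissibleSeqPoint
import Summits.ResolutionOfSingularities.ResolutionOfSingularities.Theorems.RadicialJungCleanModelsContactChainExit
import Summits.ResolutionOfSingularities.ResolutionOfSingularities.Theorems.RadicialJungCleanModelsContactChainExists
import Literature.AlgebraicGeometry.Resolution.TowerOverCurve
import Literature.AlgebraicGeometry.Resolution.PointCentrePermissible
import Literature.AlgebraicGeometry.Resolution.CanonicalResolutionSmoothCentre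
import HarnessLib

/-!
# Route `RadicialJung`, crux `CleanModels` (stmt-ResolutionOfSingularities-15917), line `Sketch` rev 35, stub 6 `stub_cleanProp44` (X44c),
# work plan O8/O6 junction: a chain of point blow-ups following a curve in the non-principal locus EXTENDS a clean-permissible
# Cossart–Piltant sequence

Memo `Cruxes/CleanModels/Lines/Sketch-memo-hand2-g10-stubs-5-7.md` §3 (O6/O8 junction).  `ρ : X → S` a clean-permissible Cossart–Piltant sequence
for `(J, G₀)` (`IsCleanRegularCentreBlowupSeq p ρ J G₀`), the line of `G₀` clean-regular everywhere on `S` (`char K(S) = p`), `X` regular,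
`C₀ ⊆ X` a regular curve INSIDE THE NON-LOCALLY-PRINCIPAL LOCUS of `J𝒪_X`, and `σ : X' → X` a chain of point blow-ups following `C₀` at a
closed point `σ x` (`dim 𝒪 = 3`, `σ x ∈ cl(C₀ ∖ {σ x})`).  Then `X'` is integral, `σ` is dominant, and `σ ≫ ρ` is again a clean-permissible
Cossart–Piltant sequence for `(J, G₀)` (`IsPointChainAlong.isCleanRegularCentreBlowupSeq`): each blown-up point is a regular integral centre
(✓ `isIntegral_subscheme_vanishingIdeal_singleton`), lies in the non-principal locus (it is in the closure of the rest of the current strict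
transform ✓ `IsPointChainAlong.mem_closure_sdiff`, which lies over `C₀ ∖ {σ x}` where `σ` is a local isomorphism ✓ p816554 /
✓ `isLocallyPrincipalAt_of_comap_of_isIso_stalkMap`), and the line is clean-regular there (✓ `IsCleanRegularCentreBlowupSeq.cleanRegAt`), so
✓ `IsCleanRegularCentreBlowupSeq.cons_point` applies.

Honest framing: OURS (bookkeeping towards recording L7b-global's `σ` in X44c's predicate); nothing here proves X44c or any case of `CleanModels`.
-/

noncomputable section

set_option linter.dupNamespace false -- mandated namespace of this single-conjunct summit

open CategoryTheory AlgebraicGeometry TopologicalSpace IsLocalRing Opposite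
open Literature.AlgebraicGeometry.Resolution Literature.AlgebraicGeometry.Motives
open Scheme.IdealSheafData

namespace Summit.ResolutionOfSingularities.ResolutionOfSingularities.Theorems.RadicialJung.CleanModels

/-- **A chain of point blow-ups following a curve in the non-principal locus extends a clean-permissible Cossart–Piltant sequence.**  See the
module docstring. [cite: CossartPiltant2019, Prop. 4.4 (i)] [cite: Piltant2013, §2 Axiom 4] [cite: StacksProject, Tag 02ND] -/
theorem IsPointChainAlong.isCleanRegularCentreBlowupSeq {p : ℕ} (hp : p.Prime) {S X : Scheme.{0}} [IsIntegral S] [IsIntegral X]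
    [IsLocallyNoetherian X] {ρ : X ⟶ S} [IsDominant ρ] {J : S.IdealSheafData} {G₀ : S.functionField} [CharP S.functionField p]
    (hρ : IsCleanRegularCentreBlowupSeq p ρ J G₀) (hG₀ : ∀ s : S, CleanRegAt p (algebraMap (S.presheaf.stalk s) S.functionField) G₀)
    (hX : Scheme.IsRegular X) {C₀ : Closeds X}
    (hC₀reg : ∀ y ∈ (C₀ : Set X), ∃ c : Fin 2 → X.presheaf.stalk y, IsRsopPart c ∧ Ideal.span (Set.range c) = stalkIdeal (vanishingIdeal C₀) y)
    (hnp : ∀ y ∈ (C₀ : Set X), ¬ IsLocallyPrincipalAt (J.comap ρ) y)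
    {X' : Scheme.{0}} [IsLocallyNoetherian X'] {σ : X' ⟶ X} {C : Closeds X'} {x : X'} {n : ℕ} (h : IsPointChainAlong σ C₀ C x n)
    (hxC₀ : σ x ∈ (C₀ : Set X)) (hdim₀ : ringKrullDim (X.presheaf.stalk (σ x)) = 3) (hx₀cl : IsClosed ({σ x} : Set X))
    (h0 : σ x ∈ closure ((C₀ : Set X) \ {σ x})) :
    ∃ (_ : IsIntegral X') (_ : IsDominant σ), IsCleanRegularCentreBlowupSeq p (σ ≫ ρ) J G₀ := by
  induction h with
  | nil C₀ x₀ =>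
    refine ⟨inferInstance, inferInstance, ?_⟩
    simpa using hρ
  | cons σ C₀ C n τ x' hx hchain hYreg hτ hx' ih =>
    have hστ : (τ ≫ σ) x' = σ (τ x') := by rw [Scheme.Hom.comp_apply]
    rw [hστ] at hxC₀ hdim₀ hx₀cl h0
    obtain ⟨hXint, hσdom, hseq⟩ := ih hC₀reg hnp hxC₀ hdim₀ hx₀cl h0
    haveI := hXint
    haveI := hσdom
    obtain ⟨hXreg, hCreg, hxC, hdimx⟩ := data_along_pointChain hchain hX hC₀reg hxC₀ hdim₀
    -- the centre ideal is nonzero: it contains a regular parameter at `τ x'`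
    have hYbot : vanishingIdeal (⟨{τ x'}, hx⟩ : Closeds _) ≠ ⊥ := by
      intro hbot
      obtain ⟨c, hc, hspan⟩ := hCreg (τ x') hxC
      haveI := hc.1
      have hPle : stalkIdeal (vanishingIdeal C) (τ x') ≤ maximalIdeal _ :=
        (mem_support_iff_stalkIdeal_le _ _).mp
          (by rw [← SetLike.mem_coe, Scheme.IdealSheafData.coe_support_vanishingIdeal]; exact hxC)
      have hc0 : c 0 ∈ stalkIdeal (vanishingIdeal (⟨{τ x'}, hx⟩ : Closeds _)) (τ x') := by
        rw [stalkIdeal_vanishingIdeal_singleton hx]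
        exact hPle (hspan ▸ Ideal.subset_span ⟨0, rfl⟩)
      rw [hbot, stalkIdeal_bot, Ideal.mem_bot] at hc0
      exact hc.ne_zero 0 hc0
    haveI : IsIntegral _ := hτ.isIntegral hYbot
    haveI : IsDominant τ := isDominant_of_isBlowup_of_ne_bot hτ hYbot
    -- the blown-up point lies in the non-principal locus of `J𝒪`
    have hnp' : ¬ IsLocallyPrincipalAt (J.comap (σ ≫ ρ)) (τ x') := by
      have hsub : (C : Set _) \ {τ x'} ⊆ (nonPrincipalLocus (J.comap (σ ≫ ρ)) : Set _) := by
        rintro y ⟨hyC, hyx⟩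
        have hne : σ y ≠ σ (τ x') := fun heq => hyx (hchain.eq_of_mem_of_eq hX hC₀reg hxC₀ hdim₀ y hyC heq)
        have hyC₀ : σ y ∈ (C₀ : Set X) := by
          have h1 : y ∈ (C : Set _) ∩ σ ⁻¹' {σ (τ x')}ᶜ := ⟨hyC, hne⟩
          rw [hchain.inter_preimage_compl hx₀cl] at h1
          exact h1.1
        obtain ⟨hiso, -⟩ := hchain.stalkIdeal_eq_map_of_ne hx₀cl y hne
        haveI := hiso
        change ¬ IsLocallyPrincipalAt (J.comap (σ ≫ ρ)) y
        rw [Scheme.IdealSheafData.comap_comp]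
        exact fun hprin => hnp _ hyC₀ (isLocallyPrincipalAt_of_comap_of_isIso_stalkMap σ hprin)
      have hmem : τ x' ∈ (nonPrincipalLocus (J.comap (σ ≫ ρ)) : Set _) :=
        ((nonPrincipalLocus (J.comap (σ ≫ ρ))).isClosed.closure_subset_iff.mpr hsub) (hchain.mem_closure_sdiff h0)
      exact hmem
    have hint := isIntegral_subscheme_vanishingIdeal_singleton hx
    have key := IsCleanRegularCentreBlowupSeq.cons_point hp τ (σ ≫ ρ) J G₀ hseq (τ x') hx hint hYreg hnp' hτ
      (hseq.cleanRegAt hp inferInstance hG₀ (τ x'))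
    refine ⟨inferInstance, inferInstance, ?_⟩
    simpa only [Category.assoc] using key

end Summit.ResolutionOfSingularities.ResolutionOfSingularities.Theorems.RadicialJung.CleanModels

end
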